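import Literature.NumberTheory.ComplexMultiplication.CMTypeRankCommonConstituent
import Literature.NumberTheory.ComplexMultiplication.PartialConjugationOfConjSquare
import HarnessLib

/-!
# Partial conjugations meeting ONE CONJUGATE of the partner field: a Galois closure `L` and a single image `y₀(K)`
# meeting in a totally real field already exclude common constituents

Companion of `NumberTheory/ComplexMultiplication/CMTypeRankCommonConstituent` (the pairwise "no common constituent"
criterion for the rank of a family of CM types, with the sufficient condition `pairwise_of_partialConj`: some `σ ∈ G`
acting as `ρ` on the slot `E_i` and TRIVIALLY ON THE WHOLE SLOT `E_j`) and of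
`NumberTheory/ComplexMultiplication/PartialConjugationOfRealIntersection` (for `G = Aut(ℂ)` on `E_i = Hom(K_i, ℂ)` such a
`σ` exists iff complex conjugation fixes `L_i ∩ L_j` pointwise, `L_i`, `L_j` the Galois closures in `ℂ`).  The point of
this file: in the exclusion argument it suffices that `σ` FIXES ONE POINT `y₀` of a transitive slot `E_j` — the other
points are reached by translating inside the `G`-stable subspace.  On number fields the price drops from "`L_i ∩ L_j`
totally real" to "`L_i ∩ y₀(K_j)` totally real" for ONE embedding `y₀ : K_j → ℂ` (the image of one conjugate, not the
Galois closure), which is strictly weaker as soon as `K_j` is not Galois: e.g. an imaginary quadratic `k = K_i` lying in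
`L_j` but not in `K_j` (Moonen–Zarhin's "no embedding `k ↪ End⁰(X₂)`", the tree's `CMTypeRankForeignQuadraticSlot`), or a
cyclic quartic CM field `K_i` contained in `L_j` but not in `K_j` (§4 below; consumed in
`Summits/HodgeConjecture/CorCM/CyclicCMSurfaceTimesCMHodge`).

## What is proved (everything; theorems only, no definition, no named fact, no `sorry`)

* §1 (abstract, a group `G` acting slot by slot on `⊔_i E_i`, conjugation `ρ`):
  **`pairwise_of_rho_on_slot_of_smul_eq`** — if some `σ ∈ G` acts as `ρ` on `E_i` and fixes ONE point `y₀` of `E_j`,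
  and `G` is transitive on `E_j`, then `U(Φ_i)` and `U(Φ_j)` have no common constituent, in both orders (the hypothesis
  shape `hpair` of `map_slotExt_antiSpan_le_of_pairwise`).  Proof: for an equivariant `T` on a stable `P ≤ U(Φ_i)`,
  `(T f)(y₀) = (T f)(σ y₀) = (T (f ∘ σ))(y₀) = −(T f)(y₀)`, so `T f` vanishes at `y₀`, and at `g y₀` by applying this to
  `f ∘ g ∈ P`; symmetrically in the other order.
* §2 (Galois theory in `ℂ`): **`exists_ringEquiv_apply_eq_of_normal_left`** — the ONE-SIDED gluing lemma: for
  finite-dimensional intermediate fields `A`, `M` of `ℂ/ℚ` with `A` NORMAL (nothing asked of `M`) and `g ∈ Aut(ℂ)` fixing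
  `A ∩ M` pointwise, some `τ ∈ Aut(ℂ)` agrees with `g` on `A` and is the identity on `M`.  Proof inside a finite Galois
  `C ≥ A·M`: `Gal(C/A ∩ M) = Gal(C/A)·Gal(C/M)` for `A` normal (the tree's `NewtonThorne2021.fixingSubgroup_inf_eq_sup`,
  which asks normality of the first field only — Lang's `Gal(AM/M) ≅ Gal(A/A ∩ M)`), so `g|_C = a·m` with `a` trivial on
  `A` and `m` trivial on `M`, and `m = a⁻¹ g|_C` acts as `g` on the normal `A`; `m` extends from the countable `C` to `ℂ`.
* §3 (number fields `k`, `K`, one embedding `y₀ : K → ℂ`): **`exists_ringEquiv_conj_smul_and_smul_eq`** — if complex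
  conjugation fixes `L_k ∩ y₀(K)` pointwise then some `σ ∈ Aut(ℂ)` satisfies `σ ∘ u = ū` for every `u : k → ℂ` and
  `σ ∘ y₀ = y₀`; the converse **`conj_apply_eq_of_conj_smul_of_smul_eq`** (sharp), together
  **`exists_ringEquiv_conj_smul_and_smul_eq_iff`**.
* §4 **`conj_apply_eq_of_cyclic_quartic_of_isEmpty`** — for `k` a CYCLIC QUARTIC CM field not embedding in `K`, complex
  conjugation fixes `L_k ∩ y₀(K)` pointwise for every `y₀` (`L_k = u(k)` has degree `4`, is not inside `y₀(K)`, so the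
  intersection has degree `≤ 2` and is fixed by the square `conjGal` — BY NAME
  `finrank_inf_le_two_of_finrank_eq_four`, `conj_apply_eq_of_isSquare_conjGal_of_finrank_le_two`,
  `isSquare_conjGal_of_isCyclic`); hence **`exists_ringEquiv_conj_smul_and_smul_eq_of_cyclic_quartic`**.  (For the
  Galois closures this fails: `k ⊆ L_K` is allowed here.)

## References

* [Lang2002] S. Lang, *Algebra*, 3rd ed., GTM 211, VI §1 Thm. 1.12 (`Gal(KF/F) ≅ Gal(K/K ∩ F)` for `K/k` Galois and ANY
  extension `F/k`), V §2 Thm. 2.8.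
* [Gordon1999HodgeAVSurvey] B. B. Gordon, *A survey of the Hodge conjecture for abelian varieties*, §3 Theorem (Imai,
  Murty) with proof ("acts as `+1` on `X(K^×_{1,1})` and `−1` on the other components"); 7.5.
* [MoonenZarhin1999LowDim] B. Moonen, Yu. Zarhin, *Hodge classes on abelian varieties of low dimension*, Math. Ann. 315
  (1999), Thm. (0.2) (a)/(4) (the shape "`k ↪ End⁰`" of the obstruction).
* [Shimura1998] G. Shimura, *Abelian Varieties with Complex Multiplication and Modular Functions*, §8.4 Example (2)(B)
  (cyclic quartic CM fields).
-/

set_option autoImplicit false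

noncomputable section

open IntermediateField Module NumberField

namespace Literature.NumberTheory.ComplexMultiplication

/-! ### §1 A conjugation on one slot fixing ONE point of a transitive slot excludes common constituents -/

section Abstract

variable {G : Type*} [Group G] {I : Type*} {E : I → Type*} [∀ i, MulAction G (E i)]

/-- **`σ = ρ` on `E_i`, `σ y₀ = y₀` for one `y₀` in a transitive `E_j` ⟹ no common constituent, in both orders.**  If
some `σ ∈ G` acts as the conjugation `ρ` on the slot `E_i` and fixes a point `y₀` of the slot `E_j` on which `G` acts
transitively, then no non-zero `G`-stable `P ≤ U(Φ_i)` carries an equivariant linear map injective on `P` into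
`U(Φ_j)`, nor vice versa (`σ` is `−1` on `U(Φ_i)`; evaluate at `y₀ = σ y₀` and translate).  Generalises
`pairwise_of_partialConj` (`σ` trivial on all of `E_j`). [cite: Gordon1999HodgeAVSurvey, §3 Theorem (proof)] -/
theorem pairwise_of_rho_on_slot_of_smul_eq {ρ : G} {Φ : ∀ i, Set (E i)} (h : ∀ i, IsCMTypeWith ρ (Φ i)) {i j : I}
    {σ : G} (hσi : ∀ s : E i, σ • s = ρ • s) {y₀ : E j} (hσj : σ • y₀ = y₀)
    (htrans : ∀ y : E j, ∃ g : G, g • y₀ = y) :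
    (∀ P : Submodule ℚ (E i → ℚ), P ≤ antiSpan G (Φ i) →
      (∀ g : G, ∀ f ∈ P, (fun x => f (g • x)) ∈ P) →
      ∀ T : (E i → ℚ) →ₗ[ℚ] (E j → ℚ),
        (∀ g : G, ∀ f ∈ P, T (fun x => f (g • x)) = fun y => T f (g • y)) →
        (∀ f ∈ P, T f ∈ antiSpan G (Φ j)) → (∀ f ∈ P, T f = 0 → f = 0) → P = ⊥) ∧
    (∀ P : Submodule ℚ (E j → ℚ), P ≤ antiSpan G (Φ j) →
      (∀ g : G, ∀ f ∈ P, (fun x => f (g • x)) ∈ P) →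
      ∀ T : (E j → ℚ) →ₗ[ℚ] (E i → ℚ),
        (∀ g : G, ∀ f ∈ P, T (fun x => f (g • x)) = fun y => T f (g • y)) →
        (∀ f ∈ P, T f ∈ antiSpan G (Φ i)) → (∀ f ∈ P, T f = 0 → f = 0) → P = ⊥) := by
  constructor
  · intro P hPU hPst T hTeq _ hTinj
    -- every `T f`, `f ∈ P`, vanishes at `y₀`
    have hzero : ∀ f ∈ P, T f y₀ = 0 := by
      intro f hf
      have h1 : (fun x => f (σ • x)) = -f := by
        funext x
        rw [hσi x, apply_rho_smul_of_mem_antiSpan (h i) (hPU hf) x, Pi.neg_apply]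
      have h2 := congrFun (hTeq σ f hf) y₀
      rw [h1, map_neg, hσj, Pi.neg_apply] at h2
      -- `h2 : -(T f y₀) = T f y₀`
      linarith
    refine (Submodule.eq_bot_iff P).2 fun f hf => hTinj f hf (funext fun y => ?_)
    obtain ⟨g, rfl⟩ := htrans y
    have h3 := congrFun (hTeq g f hf) y₀
    -- `h3 : T (f ∘ g) y₀ = T f (g • y₀)`
    rw [← h3]
    exact hzero _ (hPst g f hf)
  · intro P hPU hPst T hTeq hTU hTinj
    -- every `f ∈ P` vanishes at `y₀`
    have hzero : ∀ f ∈ P, f y₀ = 0 := by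
      intro f hf
      have h1 : (fun y => T f (σ • y)) = -T f := by
        funext y
        rw [hσi y, apply_rho_smul_of_mem_antiSpan (h i) (hTU f hf) y, Pi.neg_apply]
      have h2 : T ((fun x => f (σ • x)) + f) = 0 := by
        rw [map_add, hTeq σ f hf, h1, neg_add_cancel]
      have h3 := hTinj _ (P.add_mem (hPst σ f hf) hf) h2
      have h4 := congrFun h3 y₀
      rw [Pi.add_apply, hσj, Pi.zero_apply] at h4
      linarith
    refine (Submodule.eq_bot_iff P).2 fun f hf => funext fun y => ?_
    obtain ⟨g, rfl⟩ := htrans y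
    exact hzero _ (hPst g f hf)

end Abstract

/-! ### §2 The one-sided gluing lemma: `τ = g` on a NORMAL `A`, `τ = id` on an ARBITRARY `M`, when `g` fixes `A ∩ M` -/

section Engine

/-- A finite extension of `ℚ` (inside `ℂ`) is countable. [folklore] -/
private theorem countable_of_finiteDimensional₁₆ (C : IntermediateField ℚ ℂ) [FiniteDimensional ℚ C] : Countable C :=
  Countable.of_equiv _ (Module.finBasis ℚ C).equivFun.toEquiv.symm

/-- An automorphism of `ℂ` fixes `ℚ`. [folklore] -/
private theorem ringEquiv_apply_algebraMap₁₆ (g : ℂ ≃+* ℂ) (q : ℚ) : g (algebraMap ℚ ℂ q) = algebraMap ℚ ℂ q := by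
  rw [eq_ratCast]
  exact map_ratCast g q

variable {A M : IntermediateField ℚ ℂ}

/-- **One-sided gluing lemma.**  Let `A`, `M` be finite-dimensional intermediate fields of `ℂ/ℚ` with `A` NORMAL over
`ℚ` (nothing is asked of `M`), and let `g ∈ Aut(ℂ)` fix `A ∩ M` pointwise.  Then some `τ ∈ Aut(ℂ)` agrees with `g` on
`A` and is the identity on `M`: inside a finite Galois `C ⊇ A·M`, `Gal(C/A ∩ M) = Gal(C/A)·Gal(C/M)` because `A` is
normal (`Gal(AM/M) ≅ Gal(A/A ∩ M)`), so `g|_C = a·m` with `a|_A = id`, `m|_M = id`, and `m = a⁻¹ g|_C` is `g` on `A`;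
`m` extends to `ℂ`. [cite: Lang2002, VI §1 Thm. 1.12 and V §2 Thm. 2.8] -/
theorem exists_ringEquiv_apply_eq_of_normal_left [FiniteDimensional ℚ A] [FiniteDimensional ℚ M]
    [@Normal ℚ A _ _ (IntermediateField.algebra' A)]
    (g : ℂ ≃+* ℂ) (hg : ∀ x : ℂ, x ∈ A → x ∈ M → g x = x) :
    ∃ τ : ℂ ≃+* ℂ, (∀ a : ℂ, a ∈ A → τ a = g a) ∧ ∀ b : ℂ, b ∈ M → τ b = b := by
  classical
  -- pin the `ℚ`-algebra structures
  letI iA : Algebra ℚ ↥A := IntermediateField.algebra' A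
  letI iAM : Algebra ℚ ↥(A ⊔ M) := IntermediateField.algebra' (A ⊔ M)
  -- a finite normal `C ≥ A ⊔ M`
  let C : IntermediateField ℚ ℂ := normalClosure ℚ ↥(A ⊔ M) ℂ
  letI iC : Algebra ℚ ↥C := IntermediateField.algebra' C
  have hAMC : A ⊔ M ≤ C := IntermediateField.le_normalClosure (A ⊔ M)
  have hAC : A ≤ C := le_sup_left.trans hAMC
  have hMC : M ≤ C := le_sup_right.trans hAMC
  haveI : IsNormalClosure ℚ ↥(A ⊔ M) ↥C :=
    Algebra.IsAlgebraic.isNormalClosure_normalClosure fun x => IsAlgClosed.splits _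
  haveI hCn : Normal ℚ ↥C := IsNormalClosure.normal (K := ↥(A ⊔ M))
  haveI : FiniteDimensional ℚ ↥C := normalClosure.is_finiteDimensional ℚ ↥(A ⊔ M) ℂ
  haveI : Algebra.IsSeparable ℚ ↥C := Algebra.IsAlgebraic.isSeparable_of_perfectField
  haveI : IsGalois ℚ ↥C := ⟨⟩
  -- `A`, `M` as intermediate fields `A'`, `M'` of `C/ℚ`; `A'` is normal
  letI iA' : Algebra ℚ ↥(IntermediateField.restrict hAC) := IntermediateField.algebra' _
  haveI : Normal ℚ ↥(IntermediateField.restrict hAC) :=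
    Normal.of_algEquiv (IntermediateField.restrict_algEquiv hAC)
  haveI : Algebra.IsSeparable ℚ ↥(IntermediateField.restrict hAC) :=
    Algebra.IsAlgebraic.isSeparable_of_perfectField
  haveI : IsGalois ℚ ↥(IntermediateField.restrict hAC) := ⟨⟩
  -- `g` restricted to the normal `C`
  let gQ : ℂ ≃ₐ[ℚ] ℂ := AlgEquiv.ofRingEquiv (f := g) (ringEquiv_apply_algebraMap₁₆ g)
  let gC : ↥C ≃ₐ[ℚ] ↥C := gQ.restrictNormal ↥C
  have hgC : ∀ x : ↥C, ((gC x : ↥C) : ℂ) = g x := fun x => AlgEquiv.restrictNormal_commutes gQ (↥C) x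
  -- `gC` fixes `A' ∩ M'`, hence lies in `Gal(C/A')·Gal(C/M')`
  have hfix : gC ∈ (IntermediateField.restrict hAC ⊓ IntermediateField.restrict hMC).fixingSubgroup := by
    rw [IntermediateField.mem_fixingSubgroup_iff]
    intro x hx
    apply Subtype.ext
    rw [hgC]
    exact hg x ((IntermediateField.mem_restrict hAC x).1 hx.1) ((IntermediateField.mem_restrict hMC x).1 hx.2)
  rw [Literature.NumberTheory.Automorphic.NewtonThorne2021.fixingSubgroup_inf_eq_sup, ← SetLike.mem_coe,
    Subgroup.normal_mul] at hfix
  obtain ⟨a, ha, m, hm, hprod⟩ := Set.mem_mul.mp hfix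
  have ha' := (IntermediateField.mem_fixingSubgroup_iff _ _).1 (inv_mem (SetLike.mem_coe.1 ha))
  have hm' := (IntermediateField.mem_fixingSubgroup_iff _ _).1 (SetLike.mem_coe.1 hm)
  have hmeq : m = a⁻¹ * gC := eq_inv_mul_of_mul_eq hprod
  -- `m` acts as `g` on `A` and trivially on `M`
  have hma : ∀ (x : ℂ) (hx : x ∈ A), ((m ⟨x, hAC hx⟩ : ↥C) : ℂ) = g x := by
    intro x hx
    have hxA' : (⟨x, hAC hx⟩ : ↥C) ∈ IntermediateField.restrict hAC := (IntermediateField.mem_restrict hAC _).2 hx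
    -- `gC x ∈ A'` since `A'` is normal
    have hgx : gC ⟨x, hAC hx⟩ ∈ IntermediateField.restrict hAC := by
      have e := AlgEquiv.restrictNormal_commutes gC (↥(IntermediateField.restrict hAC)) ⟨_, hxA'⟩
      -- `e : algebraMap A' C (gC.restrictNormal A' ⟨x,_⟩) = gC (algebraMap A' C ⟨x,_⟩)`
      change ((gC.restrictNormal (↥(IntermediateField.restrict hAC)) ⟨_, hxA'⟩ :
        ↥(IntermediateField.restrict hAC)) : ↥C) = gC ⟨x, hAC hx⟩ at e
      rw [← e]
      exact Subtype.mem _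
    rw [hmeq, AlgEquiv.mul_apply, ha' _ hgx, hgC]
  have hmb : ∀ (x : ℂ) (hx : x ∈ M), ((m ⟨x, hMC hx⟩ : ↥C) : ℂ) = x := by
    intro x hx
    rw [hm' _ ((IntermediateField.mem_restrict hMC _).2 hx)]
  -- extend `m` from the countable field `C` to `ℂ`
  haveI : Countable ↥C := countable_of_finiteDimensional₁₆ C
  obtain ⟨τ, hτ⟩ := Literature.AlgebraicGeometry.Motives.ZarhinLie.exists_ringEquiv_complex_comp_eq
    (algebraMap (↥C) ℂ) ((algebraMap (↥C) ℂ).comp m.toRingEquiv.toRingHom)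
  refine ⟨τ, fun x hx => ?_, fun x hx => ?_⟩
  · exact (hτ ⟨x, hAC hx⟩).trans (hma x hx)
  · exact (hτ ⟨x, hMC hx⟩).trans (hmb x hx)

/-- Symmetric form: `τ = id` on an ARBITRARY `M` and `τ = g` on a NORMAL `A` (same statement, arguments swapped for
convenient rewriting). [cite: Lang2002, VI §1 Thm. 1.12] -/
theorem exists_ringEquiv_apply_eq_of_normal_right [FiniteDimensional ℚ A] [FiniteDimensional ℚ M]
    [@Normal ℚ A _ _ (IntermediateField.algebra' A)]
    (g : ℂ ≃+* ℂ) (hg : ∀ x : ℂ, x ∈ M → x ∈ A → g x = x) :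
    ∃ τ : ℂ ≃+* ℂ, (∀ b : ℂ, b ∈ M → τ b = b) ∧ ∀ a : ℂ, a ∈ A → τ a = g a := by
  obtain ⟨τ, h1, h2⟩ := exists_ringEquiv_apply_eq_of_normal_left (A := A) (M := M) g fun x hA hM => hg x hM hA
  exact ⟨τ, h2, h1⟩

end Engine

/-! ### §3 Number fields: conjugation on every embedding of `k`, fixing ONE embedding `y₀` of `K` -/

section NumberFields

variable {k K : Type} [Field k] [NumberField k] [Field K] [NumberField K]

/-- The image of an embedding of a number field is finite over `ℚ`. [folklore] -/
private theorem finiteDimensional_fieldRange₁₆ (s : K →+* ℂ) : FiniteDimensional ℚ s.toRatAlgHom.fieldRange :=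
  LinearEquiv.finiteDimensional (AlgEquiv.ofInjectiveField s.toRatAlgHom).toLinearEquiv

/-- A subfield of a finite extension (inside `ℂ`) is finite. [folklore] -/
private theorem finiteDimensional_of_le₁₆ {F F' : IntermediateField ℚ ℂ} [FiniteDimensional ℚ F] (h : F' ≤ F) :
    FiniteDimensional ℚ F' :=
  FiniteDimensional.of_injective (IntermediateField.inclusion h).toLinearMap (IntermediateField.inclusion_injective h)

/-- **Conjugation on `Hom(k, ℂ)` fixing one `y₀ ∈ Hom(K, ℂ)`.**  If complex conjugation fixes `L_k ∩ y₀(K)` pointwise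
(`L_k = normalClosure ℚ k ℂ` the Galois closure of `k` in `ℂ`, `y₀(K)` the image of ONE embedding), then some
`σ ∈ Aut(ℂ)` satisfies `σ ∘ u = ū` for every embedding `u : k → ℂ` and `σ ∘ y₀ = y₀` (the one-sided gluing lemma with
`A = L_k`, `M = y₀(K)`, `g` = conjugation). [cite: Lang2002, VI §1 Thm. 1.12] -/
theorem exists_ringEquiv_conj_smul_and_smul_eq (y₀ : K →+* ℂ)
    (hreal : ∀ x : ℂ, x ∈ normalClosure ℚ k ℂ → x ∈ y₀.toRatAlgHom.fieldRange → starRingEnd ℂ x = x) :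
    ∃ σ : ℂ ≃+* ℂ, (∀ u : k →+* ℂ, σ • u = (starRingAut : ℂ ≃+* ℂ) • u) ∧ σ • y₀ = y₀ := by
  haveI : @Normal ℚ ↥(normalClosure ℚ k ℂ) _ _ (IntermediateField.algebra' _) :=
    normal_normalClosure_complex (I := Unit) (K := fun _ => k) ()
  haveI : FiniteDimensional ℚ y₀.toRatAlgHom.fieldRange := finiteDimensional_fieldRange₁₆ y₀
  obtain ⟨τ, hA, hM⟩ := exists_ringEquiv_apply_eq_of_normal_left (A := normalClosure ℚ k ℂ)
    (M := y₀.toRatAlgHom.fieldRange) (starRingAut : ℂ ≃+* ℂ)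
    (fun x h₁ h₂ => by rw [starRingAut_apply, ← starRingEnd_apply]; exact hreal x h₁ h₂)
  refine ⟨τ, fun u => RingHom.ext fun x => ?_, RingHom.ext fun x => ?_⟩
  · rw [ringEquiv_smul_apply, ringEquiv_smul_apply]
    exact hA _ (apply_mem_normalClosure (I := Unit) (K := fun _ => k) () u x)
  · rw [ringEquiv_smul_apply]
    exact hM _ (AlgHom.mem_fieldRange.2 ⟨x, rfl⟩)

/-- **Sharpness.**  If some `σ ∈ Aut(ℂ)` is complex conjugation on every embedding of `k` and fixes the embedding
`y₀ : K → ℂ`, then complex conjugation fixes `L_k ∩ y₀(K)` pointwise (`σ` IS conjugation on `L_k` and the identity on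
`y₀(K)`). [cite: Lang2002, VI §1 Thm. 1.12] -/
theorem conj_apply_eq_of_conj_smul_of_smul_eq {y₀ : K →+* ℂ} {σ : ℂ ≃+* ℂ}
    (hσ : ∀ u : k →+* ℂ, σ • u = (starRingAut : ℂ ≃+* ℂ) • u) (hσ' : σ • y₀ = y₀)
    {x : ℂ} (h₁ : x ∈ normalClosure ℚ k ℂ) (h₂ : x ∈ y₀.toRatAlgHom.fieldRange) : starRingEnd ℂ x = x := by
  have hx₁ : σ x = starRingEnd ℂ x := by
    rw [apply_eq_of_forall_smul_eq (I := Unit) (K := fun _ => k) () hσ h₁, starRingAut_apply, starRingEnd_apply]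
  obtain ⟨z, rfl⟩ := AlgHom.mem_fieldRange.1 h₂
  have hx₂ : σ (y₀.toRatAlgHom z) = y₀.toRatAlgHom z := by
    change σ (y₀ z) = y₀ z
    rw [← ringEquiv_smul_apply σ y₀ z, hσ']
  rw [← hx₁, hx₂]

/-- **The criterion is an equivalence**: some `σ ∈ Aut(ℂ)` is conjugation on `Hom(k, ℂ)` and fixes `y₀` iff complex
conjugation fixes `L_k ∩ y₀(K)` pointwise. [cite: Lang2002, VI §1 Thm. 1.12] -/
theorem exists_ringEquiv_conj_smul_and_smul_eq_iff (y₀ : K →+* ℂ) :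
    (∃ σ : ℂ ≃+* ℂ, (∀ u : k →+* ℂ, σ • u = (starRingAut : ℂ ≃+* ℂ) • u) ∧ σ • y₀ = y₀) ↔
      ∀ x : ℂ, x ∈ normalClosure ℚ k ℂ → x ∈ y₀.toRatAlgHom.fieldRange → starRingEnd ℂ x = x :=
  ⟨fun ⟨_, hσ, hσ'⟩ _ h₁ h₂ => conj_apply_eq_of_conj_smul_of_smul_eq hσ hσ' h₁ h₂,
    exists_ringEquiv_conj_smul_and_smul_eq y₀⟩

/-- The Galois-closure criterion of `PartialConjugationOfRealIntersection` is contained: if conjugation fixes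
`L_k ∩ L_K` pointwise then it fixes `L_k ∩ y₀(K)` for every `y₀` (`y₀(K) ≤ L_K`). [cite: Lang2002, VI §1 Thm. 1.12] -/
theorem conj_apply_eq_oneConjugate_of_normalClosure (y₀ : K →+* ℂ)
    (hreal : ∀ x : ℂ, x ∈ normalClosure ℚ k ℂ → x ∈ normalClosure ℚ K ℂ → starRingEnd ℂ x = x)
    {x : ℂ} (h₁ : x ∈ normalClosure ℚ k ℂ) (h₂ : x ∈ y₀.toRatAlgHom.fieldRange) : starRingEnd ℂ x = x :=
  hreal x h₁ (AlgHom.fieldRange_le_normalClosure y₀.toRatAlgHom h₂)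

/-! ### §4 Cyclic quartic CM fields not embedding in the partner -/

/-- If the Galois closure of `k` in `ℂ` lies in the image `y₀(K)` of an embedding of `K`, then `k` embeds in `K`.
[folklore] -/
private theorem nonempty_ringHom_of_normalClosure_le_fieldRange₁₆ (y₀ : K →+* ℂ)
    (h : normalClosure ℚ k ℂ ≤ y₀.toRatAlgHom.fieldRange) : Nonempty (k →+* K) := by
  obtain ⟨u⟩ : Nonempty (k →+* ℂ) := inferInstance
  have hu : ∀ x : k, u x ∈ y₀.toRatAlgHom.range := fun x =>
    (AlgHom.mem_range _).2 (AlgHom.mem_fieldRange.1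
      (h (apply_mem_normalClosure (I := Unit) (K := fun _ => k) () u x)))
  let incl : k →+* ↥y₀.toRatAlgHom.range :=
    { toFun := fun x => ⟨u x, hu x⟩
      map_one' := Subtype.ext (map_one u)
      map_mul' := fun x y => Subtype.ext (map_mul u x y)
      map_zero' := Subtype.ext (map_zero u)
      map_add' := fun x y => Subtype.ext (map_add u x y) }
  exact ⟨(AlgEquiv.ofInjectiveField y₀.toRatAlgHom).symm.toRingEquiv.toRingHom.comp incl⟩

/-- **A cyclic quartic CM field `k` not embedding in `K` meets every `y₀(K)` in a totally real field**: `L_k = u(k)`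
has degree `4` and is not contained in `y₀(K)` (that would embed `k` in `K`), so `[L_k ∩ y₀(K) : ℚ] ≤ 2`, and subfields
of degree `≤ 2` of `L_k` are fixed by complex conjugation, the square of a generator of `Gal(k/ℚ) ≅ ℤ/4` (the
intersection is `ℚ` or the real quadratic subfield).  No hypothesis relates `k` to the Galois closure of `K`.
[cite: Shimura1998, §8.4 Example (2)(B)] [cite: Lang2002, VI §1 Cor. 1.4] -/
theorem conj_apply_eq_of_cyclic_quartic_of_isEmpty [IsCMField k] [IsGalois ℚ k] [IsCyclic (k ≃ₐ[ℚ] k)]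
    (h4 : finrank ℚ k = 4) (he : IsEmpty (k →+* K)) (y₀ : K →+* ℂ) {x : ℂ}
    (h₁ : x ∈ normalClosure ℚ k ℂ) (h₂ : x ∈ y₀.toRatAlgHom.fieldRange) : starRingEnd ℂ x = x := by
  haveI : FiniteDimensional ℚ y₀.toRatAlgHom.fieldRange := finiteDimensional_fieldRange₁₆ y₀
  have hL4 : finrank ℚ ↥(normalClosure ℚ k ℂ) = 4 := (finrank_normalClosure_of_normal (K := k)).trans h4
  have hnle : ¬ normalClosure ℚ k ℂ ≤ y₀.toRatAlgHom.fieldRange := fun hle =>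
    he.false (Classical.choice (nonempty_ringHom_of_normalClosure_le_fieldRange₁₆ y₀ hle))
  have h2 : finrank ℚ ↥(y₀.toRatAlgHom.fieldRange ⊓ normalClosure ℚ k ℂ) ≤ 2 :=
    finrank_inf_le_two_of_finrank_eq_four _ _ hL4 hnle
  haveI : FiniteDimensional ℚ ↥(y₀.toRatAlgHom.fieldRange ⊓ normalClosure ℚ k ℂ) :=
    finiteDimensional_of_le₁₆ inf_le_left
  exact conj_apply_eq_of_isSquare_conjGal_of_finrank_le_two (isSquare_conjGal_of_isCyclic (by rw [h4]))
    (y₀.toRatAlgHom.fieldRange ⊓ normalClosure ℚ k ℂ) inf_le_right h2 ⟨h₂, h₁⟩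

/-- **A cyclic quartic CM field `k` not embedding in `K`: some `σ ∈ Aut(ℂ)` is conjugation on every embedding of `k`
and fixes the given embedding `y₀` of `K`.** [cite: Shimura1998, §8.4 Example (2)(B)] [cite: Lang2002, VI §1 Thm. 1.12] -/
theorem exists_ringEquiv_conj_smul_and_smul_eq_of_cyclic_quartic [IsCMField k] [IsGalois ℚ k]
    [IsCyclic (k ≃ₐ[ℚ] k)] (h4 : finrank ℚ k = 4) (he : IsEmpty (k →+* K)) (y₀ : K →+* ℂ) :
    ∃ σ : ℂ ≃+* ℂ, (∀ u : k →+* ℂ, σ • u = (starRingAut : ℂ ≃+* ℂ) • u) ∧ σ • y₀ = y₀ :=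
  exists_ringEquiv_conj_smul_and_smul_eq y₀ fun _ h₁ h₂ => conj_apply_eq_of_cyclic_quartic_of_isEmpty h4 he y₀ h₁ h₂

omit [NumberField k] [NumberField K] in
/-- Conversely, a `σ ∈ Aut(ℂ)` which is conjugation on `Hom(k, ℂ)` (`k` totally complex) and fixes some `y₀ : K → ℂ`
forces `k` not to embed in `K` (an embedding `e` gives `σ ∘ (y₀ ∘ e) = y₀ ∘ e` and `= \overline{y₀ ∘ e}`).
[cite: MoonenZarhin1999LowDim, Thm. (0.2) (a)] -/
theorem isEmpty_ringHom_of_conj_smul_of_smul_eq [IsTotallyComplex k] {y₀ : K →+* ℂ} {σ : ℂ ≃+* ℂ}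
    (hσ : ∀ u : k →+* ℂ, σ • u = (starRingAut : ℂ ≃+* ℂ) • u) (hσ' : σ • y₀ = y₀) : IsEmpty (k →+* K) := by
  refine ⟨fun e => ?_⟩
  have h1 : σ • (y₀.comp e) = y₀.comp e := by
    refine RingHom.ext fun x => ?_
    rw [ringEquiv_smul_apply, RingHom.comp_apply, ← ringEquiv_smul_apply σ y₀ (e x), hσ']
  have hreal : ComplexEmbedding.IsReal (y₀.comp e) := by
    rw [ComplexEmbedding.isReal_iff]
    refine RingHom.ext fun x => ?_
    have h2 := RingHom.congr_fun (hσ (y₀.comp e)) x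
    rw [h1, ringEquiv_smul_apply, starRingAut_apply] at h2
    -- `h2 : (y₀.comp e) x = star ((y₀.comp e) x)`
    rw [ComplexEmbedding.conjugate_coe_eq]
    exact h2.symm
  exact IsTotallyComplex.complexEmbedding_not_isReal (y₀.comp e) hreal

end NumberFields

end Literature.NumberTheory.ComplexMultiplication

end
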